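import Mathlib
import Summits.ResolutionOfSingularities.ResolutionOfSingularities.Theorems.FrobeniusLadderFRationalResolutionToricDegenerateRegular

/-!
# Laurent polynomial rings in finitely many variables over regular rings are regular
(crux stmt-ResolutionOfSingularities-17941 `WildQuotients.CyclicQuotientFourfolds`, line B `s1a-tamebr`, (S1)
`S1.TameToBR.InducedTorusStatement`: discharges the residual `InducedTorus.LaurentRegular` of
`…S1aInducedTorusRegular`; plan-1 ASSIGN 2026-08-27T19:48:55Z. [OURS · L1 W4.5c] — folklore glue, NOT statements
of the manuscript; counted 0. Owner res-L1-w45c-stub-4 (gen 5).)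

* one variable: the tree's `FRationalResolution.toricDegenerate_laurentPolynomial_isRegularRing` (`R` regular ⟹
  `R[T;T⁻¹]` regular, as the localisation `R[X][1/X]`);
* **`InducedTorus.isRegularRing_laurent`** — `B` regular ⟹ `B[ℤᵐ] = AddMonoidAlgebra B (Fin m → ℤ)` regular, by
  induction on `m` (`AddMonoidAlgebra.uniqueRingEquiv`; `ℤ^{m+1} ≃+ ℤ × ℤᵐ` by `Fin.consLinearEquiv`, `mapDomainRingEquiv`,
  `curryRingEquiv`).
-/

set_option linter.dupNamespace false

noncomputable section

namespace Summit.ResolutionOfSingularities.ResolutionOfSingularities.Theorems.WildQuotientResolution.S1.InducedTorus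

/-- **`B[ℤᵐ]` is regular for `B` regular**: the Laurent polynomial ring `AddMonoidAlgebra B (Fin m → ℤ)` in `m`
variables over a regular ring is a regular ring (induction on `m`: `B[ℤ^{m+1}] ≅ (B[ℤᵐ])[T;T⁻¹]`).
[OURS · L1 W4.5c] (folklore) -/
theorem isRegularRing_laurent (B : Type) [CommRing B] [IsRegularRing B] (m : ℕ) :
    IsRegularRing (AddMonoidAlgebra B (Fin m → ℤ)) := by
  induction m with
  | zero =>
    exact IsRegularRing.of_ringEquiv (AddMonoidAlgebra.uniqueRingEquiv (R := B) (Fin 0 → ℤ)).symm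
  | succ m ih =>
    haveI := ih
    haveI : IsRegularRing (LaurentPolynomial (AddMonoidAlgebra B (Fin m → ℤ))) :=
      FRationalResolution.toricDegenerate_laurentPolynomial_isRegularRing _
    exact IsRegularRing.of_ringEquiv
      ((AddMonoidAlgebra.mapDomainRingEquiv B
          (Fin.consLinearEquiv ℤ (fun _ : Fin (m + 1) => ℤ)).toAddEquiv.symm).trans
        (AddMonoidAlgebra.curryRingEquiv (R := B) (M := ℤ) (N := Fin m → ℤ))).symm

end Summit.ResolutionOfSingularities.ResolutionOfSingularities.Theorems.WildQuotientResolution.S1.InducedTorus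

end
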